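import Summits.CriticalPhenomena.CardyFormulaZ2.Theorems.CardyComplexConeEdgePrecompactUFRSMerge
import Summits.CriticalPhenomena.CardyFormulaZ2.Theorems.CardyComplexConeEdgePrecompactUFRSFailureStructure

/-!
# The first free arc of the second run and the merge that ends it
(line `qkz-strip-boundary-arm` of crux `CardyComplexCone.EdgePrecompact`, stmt-CriticalPhenomena-11387;
items 3–4 of the road map for the uniform forward response stability "UFRS", module docstring of
`Theorems/CardyComplexConeEdgePrecompactUniformForwardResponseStability.lean`, and item 2 of its
correction in `Theorems/CardyComplexConeEdgePrecompactUFRSAnnulusCrossings.lean`: the bigon)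

Setting of `splitStrands` / `ufrs_lastDeparture`: the simple `β₀`-stretch `S₀ = O₀ a [0, n]`, the
corner `e = O₀ a m` (`m ≤ n`) at which the two dynamics SPLIT (`O₁ e 1 ≠ O₀ a (m + 1)`), and the
run `O₁ e [0, T]` of the second dynamics. `…UFRSLastDeparture.lean` looks at the LAST contact of
the run with `S₀`; this file looks at the FIRST one after the split (`firstMerge`): either the
whole run `O₁ e [1, T]` is FREE of `S₀`, or its first contact `O₁ e j₁ = O₀ a i₁` (`1 ≤ j₁ ≤ T`,
earlier corners `O₁ e [1, j₁)` free) is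
* a passage through the initial corner `a = O₀ a 0` (`i₁ = 0`), or
* a MERGE: the predecessors `O₀ a (i₁ - 1) ≠ O₁ e (j₁ - 1)` are the two distinct in-darts of one
  medial vertex `M`, sent to the same corner by the two dynamics, so `M` is a discrepancy edge
  (`cTgt_not_iff_of_nextCorner_eq`); the merge vertex may be `cTgt e` itself (the run returning
  through the opposite in-dart of `e` into `O₀ a (m + 1)`). The free arc `Q = O₁ e [1, j₁)`
  and the piece of `S₀` between `e` and `M` are the two sides of the bigon of the correction's
  item 2 (if `i₁ > m + 1`; if `i₁ ≤ m` the free arc closes a loop through `e` with `O₀ a [i₁, m]`).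
No trace-back (`merge_or_through`) is needed: minimality of `j₁` makes the predecessors distinct.
`ufrs_firstMerge` is the UFRS form: the merge vertex lies in the `3η`-collar (`ufrs_mergeCollar`),
and a passage through `a` happens only for the START pair (an exit corner of the ball is entered
from the ball, which the run avoids before `T`), i.e. at the marked point `a_δ`.

References: S. Smirnov, C. R. Acad. Sci. Paris 333 (2001), §2; G. Grimmett, *The Random-Cluster
Model* (2006), §6.1.
-/

namespace Summit.CriticalPhenomena.CardyFormulaZ2.Cruxes.EdgePrecompact.QkzStripBoundaryArm

open MeasureTheory Filter Set Metric
open scoped Topology BigOperators Pointwise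
open Literature.Probability.LatticeModels Literature.Probability.Percolation
open Literature.Probability.RandomPlanarGeometry (DobrushinDomain)
open Summit.CriticalPhenomena.CardyFormulaZ2.Theses.CardyComplexCone

noncomputable section

/-! ## The first contact after the split -/

/-- **First merge** (combinatorial core, arbitrary dynamics `β₀, β₁`). Data: a stretch
`O₀ c₀ [0, n]` visiting pairwise distinct corners, a corner `e = O₀ c₀ m` on it (`m ≤ n`) at which
the second dynamics splits off (`O₁ e 1 ≠ O₀ c₀ (m + 1)`), and a horizon `T`. CONCLUSION: either
`O₁ e [1, T]` shares no corner with the stretch, or there is a first contact `O₁ e j₁ = O₀ c₀ i₁`,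
`1 ≤ j₁ ≤ T`, `i₁ ≤ n`, the corners `O₁ e [1, j₁)` off the stretch, which is a passage through
`c₀` (`i₁ = 0`) or a merge: `1 ≤ i₁`, distinct predecessors — the two in-darts of one medial
vertex — sent to the contact corner by the two dynamics, their common target edge of different
status in `β₀` and `β₁`. -/
theorem firstMerge (β₀ β₁ : BondConfig (Site 2)) (c₀ e : Site 2 × Fin 4) (m n T : ℕ) (hmn : m ≤ n)
    (he : cornerOrbit β₀ c₀ m = e)
    (hsimple : ∀ i₁ i₂ : ℕ, i₁ ≤ n → i₂ ≤ n → cornerOrbit β₀ c₀ i₁ = cornerOrbit β₀ c₀ i₂ → i₁ = i₂)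
    (hsplit : cornerOrbit β₁ e 1 ≠ cornerOrbit β₀ c₀ (m + 1)) :
    (∀ j, 1 ≤ j → j ≤ T → ∀ i ≤ n, cornerOrbit β₁ e j ≠ cornerOrbit β₀ c₀ i) ∨
    (∃ j₁ i₁ : ℕ, 1 ≤ j₁ ∧ j₁ ≤ T ∧ i₁ ≤ n ∧ cornerOrbit β₁ e j₁ = cornerOrbit β₀ c₀ i₁ ∧
      (∀ j, 1 ≤ j → j < j₁ → ∀ i ≤ n, cornerOrbit β₁ e j ≠ cornerOrbit β₀ c₀ i) ∧
      (i₁ = 0 ∨ (1 ≤ i₁ ∧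
        cornerOrbit β₀ c₀ (i₁ - 1) ≠ cornerOrbit β₁ e (j₁ - 1) ∧
        nextCorner β₀ (cornerOrbit β₀ c₀ (i₁ - 1)) = nextCorner β₁ (cornerOrbit β₁ e (j₁ - 1)) ∧
        cTgt (cornerOrbit β₀ c₀ (i₁ - 1)) = cTgt (cornerOrbit β₁ e (j₁ - 1)) ∧
        cornerOrbit β₁ e (j₁ - 1) = ((cornerOrbit β₀ c₀ (i₁ - 1)).1 + cornerUnit ((cornerOrbit β₀ c₀ (i₁ - 1)).2 + 1), (cornerOrbit β₀ c₀ (i₁ - 1)).2 + 2) ∧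
        ¬ (cTgt (cornerOrbit β₀ c₀ (i₁ - 1)) ∈ β₀ ↔ cTgt (cornerOrbit β₀ c₀ (i₁ - 1)) ∈ β₁)))) := by
  classical
  by_cases hex : ∃ j, (1 ≤ j ∧ j ≤ T) ∧ ∃ i ≤ n, cornerOrbit β₁ e j = cornerOrbit β₀ c₀ i
  swap
  · left
    intro j h1 h2 i hi h
    exact hex ⟨j, ⟨h1, h2⟩, i, hi, h⟩
  right
  obtain ⟨⟨hj1, hjT⟩, i₁, hi₁, hEq⟩ := Nat.find_spec hex
  have hmin : ∀ j < Nat.find hex, ¬ ((1 ≤ j ∧ j ≤ T) ∧ ∃ i ≤ n, cornerOrbit β₁ e j = cornerOrbit β₀ c₀ i) :=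
    fun j hj => Nat.find_min hex hj
  generalize Nat.find hex = j₁ at hj1 hjT hEq hmin
  have hfree : ∀ j, 1 ≤ j → j < j₁ → ∀ i ≤ n, cornerOrbit β₁ e j ≠ cornerOrbit β₀ c₀ i :=
    fun j h1 hj i hi h => hmin j hj ⟨⟨h1, le_trans hj.le hjT⟩, i, hi, h⟩
  refine ⟨j₁, i₁, hj1, hjT, hi₁, hEq, hfree, ?_⟩
  rcases Nat.eq_zero_or_pos i₁ with hi0 | hipos
  · exact Or.inl hi0
  · right
    -- the predecessors are distinct: by freeness if `j₁ ≥ 2`, by the split if `j₁ = 1`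
    have hne : cornerOrbit β₀ c₀ (i₁ - 1) ≠ cornerOrbit β₁ e (j₁ - 1) := by
      intro h
      rcases Nat.lt_or_ge 1 j₁ with hj2 | hj2
      · exact hfree (j₁ - 1) (by omega) (by omega) (i₁ - 1) (by omega) h.symm
      · have hj : j₁ = 1 := le_antisymm hj2 hj1
        subst hj
        have h0 : cornerOrbit β₀ c₀ (i₁ - 1) = cornerOrbit β₀ c₀ m := by rw [h, he]; rfl
        have him : i₁ - 1 = m := hsimple _ _ (by omega) hmn h0
        apply hsplit
        rw [hEq, show i₁ = m + 1 by omega]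
    have hnext : nextCorner β₀ (cornerOrbit β₀ c₀ (i₁ - 1)) = nextCorner β₁ (cornerOrbit β₁ e (j₁ - 1)) := by
      show cornerOrbit β₀ c₀ (i₁ - 1 + 1) = cornerOrbit β₁ e (j₁ - 1 + 1)
      rw [Nat.sub_add_cancel hipos, Nat.sub_add_cancel hj1]
      exact hEq.symm
    obtain ⟨htgt, hopp, hst⟩ := cTgt_not_iff_of_nextCorner_eq hne hnext
    exact ⟨hipos, hne, hnext, htgt, hopp, hst⟩

/-! ## In UFRS: the first merge sits in the collar; a passage through `a` only at the marked point -/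

/-- **The first merge of the second run** (UFRS vocabulary; registered sub-goal `ufrs_firstMerge`
of stmt-CriticalPhenomena-11387). For `η > 0` there is `δ₀ > 0` such that for every admissible datum
`E` of `D` with `E.δ < δ₀`, shift `w` with `‖E.δ w‖ < η`, ball `B(E.δ v, ρ)`, configuration `ω`,
admissible pair `(a, a')`, good `β₀`-stretch `O₀ a [0, n]` re-entering the ball at `n`, index
`m ≤ n` with `e = O₀ a m`, a run `O₁ e [0, T]` of `β₁ = (shiftData E w).bcBondConfig ω` whose
targets avoid the ball before `T`, and a split at `e` (`O₁ e 1 ≠ O₀ a (m + 1)`): either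
`O₁ e [1, T]` is free of the stretch, or its first contact `O₁ e j₁ = O₀ a i₁` is a passage through
`a` — and then `(a, a')` is the START pair and the run crosses the entry edge `cSrc a` — or a
merge at distinct predecessors whose common target edge is a discrepancy edge with its vertex in
the `3η`-collar of `∂D`. -/
theorem ufrs_firstMerge : ∀ (D : DobrushinDomain) (η : ℝ), 0 < η → ∃ δ₀ > (0:ℝ), ∀ E : DiscreteDobrushin, E.Ω = D.carrier → E.IsZdAdmissible → E.δ < δ₀ → ∀ (v w : Site 2) (ρ : ℝ), ‖meshPoint E.δ w‖ < η → ∀ (ω : BondConfig (Site 2)) (a a' : Site 2 × Fin 4) (n m T : ℕ), ((E.IsStartCorner a ∧ (shiftData E w).IsStartCorner a') ∨ (a = a' ∧ medialPoint E.δ (cSrc a) ∈ ball (meshPoint E.δ v) ρ ∧ medialPoint E.δ (cTgt a) ∉ ball (meshPoint E.δ v) ρ)) → (∀ i < n, medialPoint E.δ (cTgt (cornerOrbit (E.bcBondConfig ω) a i)) ∉ ball (meshPoint E.δ v) ρ) → medialPoint E.δ (cTgt (cornerOrbit (E.bcBondConfig ω) a n)) ∈ ball (meshPoint E.δ v) ρ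 → m ≤ n → (∀ i < T, medialPoint E.δ (cTgt (cornerOrbit ((shiftData E w).bcBondConfig ω) (cornerOrbit (E.bcBondConfig ω) a m) i)) ∉ ball (meshPoint E.δ v) ρ) → cornerOrbit ((shiftData E w).bcBondConfig ω) (cornerOrbit (E.bcBondConfig ω) a m) 1 ≠ cornerOrbit (E.bcBondConfig ω) a (m + 1) → (∀ j, 1 ≤ j → j ≤ T → ∀ i ≤ n, cornerOrbit ((shiftData E w).bcBondConfig ω) (cornerOrbit (E.bcBondConfig ω) a m) j ≠ cornerOrbit (E.bcBondConfig ω) a i) ∨ (∃ j₁ i₁ : ℕ, 1 ≤ j₁ ∧ j₁ ≤ T ∧ i₁ ≤ n ∧ cornerOrbit ((shiftData E w).bcBondConfig ω) (cornerOrbit (E.bcBondConfig ω) a m) j₁ = cornerOrbit (E.bcBondConfig ω) a i₁ ∧ (∀ j, 1 ≤ j → j < j₁ → ∀ i ≤ n, cornerOrbit ((shiftData E w).bcBondConfig ω) (cornerOrbit (E.bcBondConfig ω) a m) j ≠ cornerOrbit (E.bcBondConfig ω) a i) ∧ ((i₁ = 0 ∧ E.IsStartCorner a ∧ (shiftData E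 w).IsStartCorner a' ∧ cTgt (cornerOrbit ((shiftData E w).bcBondConfig ω) (cornerOrbit (E.bcBondConfig ω) a m) (j₁ - 1)) = cSrc a) ∨ (1 ≤ i₁ ∧ cornerOrbit (E.bcBondConfig ω) a (i₁ - 1) ≠ cornerOrbit ((shiftData E w).bcBondConfig ω) (cornerOrbit (E.bcBondConfig ω) a m) (j₁ - 1) ∧ nextCorner (E.bcBondConfig ω) (cornerOrbit (E.bcBondConfig ω) a (i₁ - 1)) = nextCorner ((shiftData E w).bcBondConfig ω) (cornerOrbit ((shiftData E w).bcBondConfig ω) (cornerOrbit (E.bcBondConfig ω) a m) (j₁ - 1)) ∧ cTgt (cornerOrbit (E.bcBondConfig ω) a (i₁ - 1)) = cTgt (cornerOrbit ((shiftData E w).bcBondConfig ω) (cornerOrbit (E.bcBondConfig ω) a m) (j₁ - 1)) ∧ cornerOrbit ((shiftData E w).bcBondConfig ω) (cornerOrbit (E.bcBondConfig ω) a m) (j₁ - 1) = ((cornerOrbit (E.bcBondConfig ω) a (i₁ - 1)).1 + cornerUnit ((cornerOrbit (E.bcBondConfig ω) a (i₁ - 1)).2 + 1), (cornerOrbit (E.bcBondConfig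 ω) a (i₁ - 1)).2 + 2) ∧ ¬ (cTgt (cornerOrbit (E.bcBondConfig ω) a (i₁ - 1)) ∈ E.bcBondConfig ω ↔ cTgt (cornerOrbit (E.bcBondConfig ω) a (i₁ - 1)) ∈ (shiftData E w).bcBondConfig ω) ∧ infDist (meshPoint E.δ (cornerOrbit (E.bcBondConfig ω) a (i₁ - 1)).1) D.carrierᶜ < 3 * η))) := by
  intro D η hη
  obtain ⟨δ₀, hδ₀, hmerge⟩ := ufrs_mergeCollar D η hη
  refine ⟨δ₀, hδ₀, ?_⟩
  intro E hEΩ hE hEδ v w ρ hw ω a a' n m T hpair hStr hball hmn hrun hsplit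
  set β₀ := E.bcBondConfig ω with hβ₀
  set β₁ := (shiftData E w).bcBondConfig ω with hβ₁
  set I : Set (Sym2 (Site 2)) := {x | medialPoint E.δ x ∈ ball (meshPoint E.δ v) ρ} with hI
  have hsimple : ∀ i₁ i₂ : ℕ, i₁ ≤ n → i₂ ≤ n → cornerOrbit β₀ a i₁ = cornerOrbit β₀ a i₂ → i₁ = i₂ :=
    fun i₁ i₂ h1 h2 h => cornerOrbit_injOn_stretch (I := I) hStr hball h1 h2 h
  rcases firstMerge β₀ β₁ a (cornerOrbit β₀ a m) m n T hmn rfl hsimple hsplit with hfree | ⟨j₁, i₁, hj1, hjT, hi₁, hEq, hbefore, hcases⟩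
  · exact Or.inl hfree
  · refine Or.inr ⟨j₁, i₁, hj1, hjT, hi₁, hEq, hbefore, ?_⟩
    rcases hcases with hi0 | ⟨hipos, hne, hnext, htgt, hopp, hst⟩
    · left
      -- passage through `a`: the run crosses the entry edge `cSrc a`, impossible for an exit corner of the ball
      have hsrc : cTgt (cornerOrbit β₁ (cornerOrbit β₀ a m) (j₁ - 1)) = cSrc a := by
        have h1 : cornerOrbit β₁ (cornerOrbit β₀ a m) (j₁ - 1 + 1) = a := by
          rw [Nat.sub_add_cancel hj1, hEq, hi0]; rfl
        rw [← cSrc_nextCorner (β := β₁) (cornerOrbit β₁ (cornerOrbit β₀ a m) (j₁ - 1))]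
        show cSrc (cornerOrbit β₁ (cornerOrbit β₀ a m) (j₁ - 1 + 1)) = cSrc a
        rw [h1]
      rcases hpair with ⟨ha, ha'⟩ | ⟨-, haI, -⟩
      · exact ⟨hi0, ha, ha', hsrc⟩
      · exfalso
        refine hrun (j₁ - 1) (by omega) ?_
        rw [hsrc]
        exact haI
    · right
      exact ⟨hipos, hne, hnext, htgt, hopp, hst, (hmerge E hEΩ hE hEδ w hw ω _ _ hne hnext).1⟩

end

end Summit.CriticalPhenomena.CardyFormulaZ2.Cruxes.EdgePrecompact.QkzStripBoundaryArm
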